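import Summits.RiemannHypothesis.RiemannHypothesis.Theorems.JensenSignTestPointwise

/-!
# Route `JensenPolynomials` (rev ≥ 8) — the FAR pointwise sign-test support `SignTestOfCoeffSmallFromFar` PROVED
(RH-FREE, ξ-free glue; cell rh-jensen, HUMAN RULING D-0040)

`XiDeltaSqPos → HermiteCriticalRatioBound rhoWinMin → XiGorttwCoeffSmallFrom rhoWinMin (2·10¹⁸) →
 ∀ d n, 3 ≤ d → 2d³ ≤ n → 2·10¹⁸ ≤ n → HermiteSignTest xiTaylorCoeff d n` — the generic pointwise blueprint
`hermiteSignTest_of_coeffSmallFrom` (theory g7, `JensenSignTestPointwise.lean`) at the far pin. Nothing here bears on the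
truth of RH.
-/

noncomputable section
-- D-0017: `Summit.RiemannHypothesis.RiemannHypothesis.…` duplicates the namespace BY DESIGN (single-problem summit).
set_option linter.dupNamespace false

namespace Summit.RiemannHypothesis.RiemannHypothesis.Theorems.JensenPolynomials

open Literature.NumberTheory.LFunctions

/-- **Item closer** (route `JensenPolynomials`, support item `SignTestOfCoeffSmallFromFar`, stmt-RiemannHypothesis-19460). -/
theorem signTestOfCoeffSmallFromFar_item :
    Summit.RiemannHypothesis.RiemannHypothesis.Theses.JensenPolynomials.SignTestOfCoeffSmallFromFar :=
  fun hΔ hH hC _ _ hd hdn hn => hermiteSignTest_of_coeffSmallFrom hΔ hH hC hd hdn hn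

end Summit.RiemannHypothesis.RiemannHypothesis.Theorems.JensenPolynomials

end
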